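import Summits.Ventures.LatticeQCDFlow.Scaling.BooleanStarPoolPotential

/-!
HONEST FRAMING: exact (Metropolis-corrected) sampling algorithms for lattice gauge theory; figures
of merit are autocorrelation/cost numbers at stated couplings and volumes; no continuum-physics
claim.

# BooleanStarPoolDrift — THE RELATIVE-DRIFT POTENTIAL PASSES THE ONE-DIMENSIONAL DRIFT INEQUALITY OF S9: THE FOUR-CASE ASSEMBLY FROM THE PER-COUNT BUDGET
# (lean-2 GEN-33, ours)

Venture-side (OURS).  Cell `lqcd-flow` (pub-lqcd), unit `pub-lqcd-lean-2-g33`, 2026-08-29.  Chapter T, file 1b, on top of `BooleanStarPoolPotential` (T1: the shape of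
the explicit relative-drift potential `S(B) = β(1 − q↑(B+1)/q↓(B+1))` above the bottom `B₀` of the one-copy drift, and its per-count budget `relDrift_pointwise`).
Abstract integer-window setting of T1 (instantiated for the homogeneous Boolean star in T3).

* **`oneCopyDrift_of_relativeDriftPotential`** — for all integers `0 ≤ B₁ < B₂ ≤ K`:
  **`ρ((B₂ − B₁) + φ(B₁) + φ(B₂)) ≤ [m(B₁) − m(B₂)] + d(B₁) + d(B₂)`**, `d(B) = q↓(B)(φ(B) − φ(B−1)) − q↑(B)(φ(B+1) − φ(B))` — which, with `m(B₁) − m(B₂)` =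
  the coupling bracket (S11 `oneCopy_bracket_eq_drift_sub`), is hypothesis `h1D` of S11 `boolStar_mixingTime_le_of_oneCopyDrift_int`.  Hypotheses: those of
  `relDrift_pointwise` and `0 < β ≤ 1/6`.  Four cases: both copies below the bottom (the bracket alone: `g ≥ 8ρ` there by antitonicity from `g(B₀) ≥ 8ρ`); the
  upper copy at the bottom (its loss `≤ |m(B₀+1)|/2 ≤ g(B₀)/2`); straddling (the bracket contains `g(B₀)` and, above it, `(B₂−B₀−1)·8ρ` in the pool zone, or the
  far copy's surplus `ρB₂` pays); both above (the two losses are `≤ β(g(B₁) + g(B₂−1)) ≤ 2β·bracket`, the lower copy's `ρφ` is paid by its own surplus or is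
  `≤ ρβ ≤ ρ`, and the rest as in the straddling case).

Toy value (work-gen33/numerics/explicit_potential.py; NOTHING CLAIMED): `κ ≥ 0.75` in units `μ_0(b)c/(h+2t)` with `β = 1/6`; typed constant in T2/T3: `1/96`.
NOT CLAIMED: the closed-form conditions (Q0), (Q2a–c) for the explicit chain (T2); anything measured.  Literature grade (cell rule): OWN, elementary; nothing cited
as a fact; no new bib keys.
-/

noncomputable section

namespace Summit.Ventures.LatticeQCDFlow.Scaling

/-! ## §3 The drift inequality for the relative-drift potential -/

/-- **THE RELATIVE-DRIFT POTENTIAL PASSES THE DRIFT INEQUALITY OF S9.**  In the setting of `relDrift_pointwise` with `0 < β ≤ 1/6`, for all integers `0 ≤ B₁ < B₂ ≤ K`: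
**`ρ((B₂ − B₁) + φ(B₁) + φ(B₂)) ≤ [m(B₁) − m(B₂)] + d(B₁) + d(B₂)`**, `d(B) = q↓(B)(φ(B) − φ(B−1)) − q↑(B)(φ(B+1) − φ(B))` — which, with `m(B₁) − m(B₂)` = the coupling
bracket (`oneCopy_bracket_eq_drift_sub`), is hypothesis `h1D` of `boolStar_mixingTime_le_of_oneCopyDrift_int`.  Four cases: both copies below the bottom (the bracket
alone, `g ≥ 8ρ` there by antitonicity from `g(B₀) ≥ 8ρ`); the upper copy at the bottom (its loss `≤ |m(B₀+1)|/2 ≤ g(B₀)/2`); straddling (the bracket contains `g(B₀)`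
and, above it, `(B₂−B₀−1)·8ρ` in the pool zone or the far copy's surplus `ρB₂`); both above (the two losses `≤ β(g(B₁)+g(B₂−1)) ≤ 2β·bracket`, and the rest as before).
[ours] -/
theorem oneCopyDrift_of_relativeDriftPotential {m qd qu S φ : ℤ → ℝ} {K B₀ Bp : ℤ} {β ρ : ℝ} (hβ0 : 0 < β) (hβ1 : β ≤ 1 / 6) (hρ : 0 ≤ ρ)
    (hm : ∀ B, m B = qu B - qd B)
    (hqdpos : ∀ B, 1 ≤ B → B ≤ K → 0 < qd B) (hqu0 : ∀ B, 0 ≤ B → B ≤ K → 0 ≤ qu B)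
    (hqdmono : ∀ B, 0 ≤ B → B + 1 ≤ K → qd B ≤ qd (B + 1)) (hqd2 : ∀ B, 1 ≤ B → B + 1 ≤ K → qd (B + 1) ≤ 2 * qd B)
    (hqumono : ∀ B, 0 ≤ B → B + 1 ≤ K → qu (B + 1) ≤ qu B) (hquK : qu K = 0)
    (hg0 : ∀ B, 0 ≤ B → B + 1 ≤ K → m (B + 1) ≤ m B)
    (hga : ∀ B, 0 ≤ B → B + 2 ≤ K → m (B + 1) - m (B + 2) ≤ m B - m (B + 1))
    (hB0 : 0 ≤ B₀) (hB0K : B₀ + 1 ≤ K) (hmB0 : 0 ≤ m B₀) (hmB1 : m (B₀ + 1) < 0)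
    (hSlo : ∀ B, B < B₀ → S B = 0) (hSmid : ∀ B, B₀ ≤ B → B + 1 ≤ K → S B = β * (1 - qu (B + 1) / qd (B + 1)))
    (hφS : ∀ B, φ (B + 1) - φ B = S B) (hφ0 : φ B₀ = 0)
    (Q0 : β * qu B₀ ≤ qd (B₀ + 1) / 2) (hBp : B₀ ≤ Bp)
    (Q2a : ∀ B, B₀ ≤ B → B ≤ Bp → B + 1 ≤ K → 8 * ρ ≤ m B - m (B + 1))
    (Q2b : ∀ B, Bp + 1 ≤ B → B + 1 ≤ K → 2 * ρ * B * qd (B + 1) ≤ β * (-m B) * (qd (B + 1) - qu B))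
    (Q2c : Bp + 1 ≤ K → 2 * ρ * K ≤ β * (-m K))
    (B₁ B₂ : ℤ) (h1 : 0 ≤ B₁) (h12 : B₁ < B₂) (h2 : B₂ ≤ K) :
    ρ * (((B₂ : ℝ) - B₁) + φ B₁ + φ B₂)
      ≤ (m B₁ - m B₂) + (qd B₁ * (φ B₁ - φ (B₁ - 1)) - qu B₁ * (φ (B₁ + 1) - φ B₁))
        + (qd B₂ * (φ B₂ - φ (B₂ - 1)) - qu B₂ * (φ (B₂ + 1) - φ B₂)) := by
  obtain ⟨P0, P1, P2, P2', U3a, U4a, U3, U4⟩ := relDrift_pointwise hβ0 (by linarith) hρ hm hqdpos hqu0 hqdmono hqd2 hqumono hquK hg0 hga hB0 hB0K hmB1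
    hSlo hSmid hφS hφ0 Q0 Q2a Q2b Q2c
  have eS : ∀ B, φ B - φ (B - 1) = S (B - 1) := fun B => by have := hφS (B - 1); rw [sub_add_cancel] at this; exact this
  rw [eS B₁, eS B₂, hφS B₁, hφS B₂]
  have h12r : (B₁ : ℝ) + 1 ≤ B₂ := by exact_mod_cast (show B₁ + 1 ≤ B₂ by linarith)
  have hB0r : (0 : ℝ) ≤ B₀ := by exact_mod_cast hB0
  -- monotone chains: `m` non-increasing, the gaps non-increasing
  have mK : ∀ B B', 0 ≤ B → B ≤ B' → B' ≤ K → m B' ≤ m B := fun B B' h0 hBB' hK =>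
    int_chain_le (f := m) (lo := 0) (hi := K - 1) (fun X hX hX' => hg0 X hX (by linarith)) h0 hBB' (by linarith)
  have gK : ∀ B B', 0 ≤ B → B ≤ B' → B' + 1 ≤ K → m B' - m (B' + 1) ≤ m B - m (B + 1) := fun B B' h0 hBB' hK =>
    int_chain_le (f := fun X => m X - m (X + 1)) (lo := 0) (hi := K - 2)
      (fun X hX hX' => by have := hga X hX (by linarith); rwa [show X + 2 = X + 1 + 1 by ring] at this) h0 hBB' (by linarith)
  have gsum : ∀ A B : ℤ, 0 ≤ A → A < B → B ≤ K → ((B : ℝ) - A) * (m (B - 1) - m B) ≤ m A - m B := fun A B hA hAB hBK =>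
    int_gap_sum_ge' (f := m) (lo := 0) (hi := K) hga hA hAB hBK
  have g0 : 8 * ρ ≤ m B₀ - m (B₀ + 1) := Q2a B₀ le_rfl hBp hB0K
  have hm1 : -m (B₀ + 1) ≤ m B₀ - m (B₀ + 1) := by linarith
  have ρβ : ρ * β ≤ ρ * (1 / 6) := mul_le_mul_of_nonneg_left hβ1 hρ
  have βg : β * (m B₀ - m (B₀ + 1)) ≤ 1 / 6 * (m B₀ - m (B₀ + 1)) := mul_le_mul_of_nonneg_right hβ1 (by linarith)
  rcases le_or_gt B₂ B₀ with hB2 | hB2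
  · rcases lt_or_eq_of_le hB2 with hB2' | hB2'
    · ---------------------------------------------------------------- CASE A: both below the bottom
      have z1 := P0 B₁ h1 (by linarith)
      have z2 := P0 B₂ (by linarith) (by linarith)
      have s := gsum B₁ B₂ h1 h12 (by linarith)
      have gl : m B₀ - m (B₀ + 1) ≤ m (B₂ - 1) - m (B₂ - 1 + 1) := gK (B₂ - 1) B₀ (by linarith) (by linarith) hB0K
      rw [show B₂ - 1 + 1 = B₂ by ring] at gl
      have p := mul_le_mul_of_nonneg_left (show ρ ≤ m (B₂ - 1) - m B₂ by linarith) (by linarith : (0 : ℝ) ≤ (B₂ : ℝ) - B₁)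
      linarith [z1, z2, s, p]
    · ---------------------------------------------------------------- CASE B: the upper copy at the bottom
      rw [hB2'] at h12 h12r ⊢
      have z1 := P0 B₁ h1 (by linarith)
      have s := gsum B₁ B₀ h1 h12 (by linarith)
      have gl : m B₀ - m (B₀ + 1) ≤ m (B₀ - 1) - m (B₀ - 1 + 1) := gK (B₀ - 1) B₀ (by linarith) (by linarith) hB0K
      rw [show B₀ - 1 + 1 = B₀ by ring] at gl
      have hx : (1 : ℝ) ≤ (B₀ : ℝ) - B₁ := by linarith
      have p1 : 0 ≤ (((B₀ : ℝ) - B₁) - 1) * ((m B₀ - m (B₀ + 1)) - ρ) := mul_nonneg (by linarith) (by linarith)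
      have p2 := mul_le_mul_of_nonneg_left gl (by linarith : (0 : ℝ) ≤ (B₀ : ℝ) - B₁)
      linarith [z1, P1, s, p1, p2, hm1]
  · rcases le_or_gt B₁ B₀ with hB1 | hB1
    · ---------------------------------------------------------------- CASE C: straddling, `B₁ ≤ B₀ < B₂`
      -- the lower copy: `ρ(B₀ − B₁) + ℓ₁ ≤ [m(B₁) − m(B₀)] + g(B₀)/2`
      have low1 : ρ * ((B₀ : ℝ) - B₁) + (ρ * φ B₁ - (qd B₁ * S (B₁ - 1) - qu B₁ * S B₁)) ≤ (m B₁ - m B₀) + (m B₀ - m (B₀ + 1)) / 2 := by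
        rcases lt_or_eq_of_le hB1 with hB1' | hB1'
        · have z1 := P0 B₁ h1 (by linarith)
          have hB1r : (B₁ : ℝ) + 1 ≤ B₀ := by exact_mod_cast (show B₁ + 1 ≤ B₀ by linarith)
          have s := gsum B₁ B₀ h1 hB1' (by linarith)
          have gl : m B₀ - m (B₀ + 1) ≤ m (B₀ - 1) - m (B₀ - 1 + 1) := gK (B₀ - 1) B₀ (by linarith) (by linarith) hB0K
          rw [show B₀ - 1 + 1 = B₀ by ring] at gl
          have p := mul_le_mul_of_nonneg_left (show ρ ≤ m (B₀ - 1) - m B₀ by linarith) (by linarith : (0 : ℝ) ≤ (B₀ : ℝ) - B₁)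
          linarith [z1, s, p, g0, hρ]
        · rw [hB1']; simp only [sub_self, mul_zero, zero_add]; linarith [P1]
      -- the upper copy
      rcases lt_or_eq_of_le (show B₀ + 1 ≤ B₂ by linarith) with hB2' | hB2'
      · -- `B₂ ≥ B₀ + 2`: `m(B₀+1) − m(B₂) ≥ (B₂ − B₀ − 1) g(B₂ − 1) ≥ 0`, and `g(B₂ − 1) ≤ g(B₀)`
        have s2 := gsum (B₀ + 1) B₂ (by linarith) hB2' h2
        push_cast at s2
        have hx2 : (1 : ℝ) ≤ (B₂ : ℝ) - B₀ - 1 := by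
          have : ((B₀ : ℝ) + 2 ≤ B₂) := by exact_mod_cast (show B₀ + 2 ≤ B₂ by linarith)
          linarith
        have gpos : 0 ≤ m (B₂ - 1) - m B₂ := by have := hg0 (B₂ - 1) (by linarith) (by linarith); rw [sub_add_cancel] at this; linarith
        have gm : m (B₂ - 1) - m (B₂ - 1 + 1) ≤ m B₀ - m (B₀ + 1) := gK B₀ (B₂ - 1) hB0 (by linarith) (by linarith)
        rw [sub_add_cancel] at gm
        have βgm := mul_le_mul_of_nonneg_left gm hβ0.le
        rcases le_or_gt B₂ Bp with hp | hp
        · -- pool: `g(B₂ − 1) ≥ 8ρ`, loss `ℓ₂ ≤ βg(B₂−1) ≤ βg(B₀)`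
          have gl := Q2a (B₂ - 1) (by linarith) (by linarith) (by linarith)
          rw [sub_add_cancel] at gl
          have up2 := U3 B₂ (by linarith) hp h2
          have p := mul_le_mul_of_nonneg_left (show ρ ≤ m (B₂ - 1) - m B₂ by linarith) (by linarith : (0 : ℝ) ≤ (B₂ : ℝ) - B₀ - 1)
          linarith [low1, s2, up2, p, g0, βg, βgm, hρ]
        · -- far: loss `ℓ₂ ≤ βg(B₂−1) − ρB₂`
          have up2 := U4 B₂ (by linarith) (by linarith) h2
          have p : 0 ≤ ((B₂ : ℝ) - B₀ - 1) * (m (B₂ - 1) - m B₂) := mul_nonneg (by linarith) gpos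
          have p2 := mul_nonneg hρ hB0r
          linarith [low1, s2, up2, p, p2, g0, βg, βgm, hρ]
      · -- `B₂ = B₀ + 1`
        subst hB2'
        have up2 : ρ * φ (B₀ + 1) - (qd (B₀ + 1) * S (B₀ + 1 - 1) - qu (B₀ + 1) * S (B₀ + 1)) ≤ ρ * β + β * (m B₀ - m (B₀ + 1)) := by
          rcases lt_or_eq_of_le h2 with h2' | h2'
          · have := P2 (by linarith)
            have gm := gK B₀ (B₀ + 1) hB0 (by linarith) (by linarith)
            rw [show B₀ + 1 + 1 = B₀ + 2 by ring] at gm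
            have := mul_le_mul_of_nonneg_left gm hβ0.le
            linarith
          · have := P2' h2'
            rw [← h2'] at this
            have := mul_nonneg hβ0.le (show 0 ≤ m B₀ - m (B₀ + 1) by linarith)
            linarith
        push_cast
        linarith [low1, up2, g0, ρβ, βg, hρ]
    · ---------------------------------------------------------------- CASE D: both above the bottom, `B₀ + 1 ≤ B₁ < B₂`
      have hB1K : B₁ + 1 ≤ K := by linarith
      have hB1r : (1 : ℝ) ≤ B₁ := by exact_mod_cast (show (1 : ℤ) ≤ B₁ by linarith)
      -- the lower copy: `ℓ₁ ≤ ρβ + βg(B₁)`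
      have low1 : ρ * φ B₁ - (qd B₁ * S (B₁ - 1) - qu B₁ * S B₁) ≤ ρ * β + β * (m B₁ - m (B₁ + 1)) := by
        have ρβ0 := mul_nonneg hρ hβ0.le
        rcases lt_or_eq_of_le (show B₀ + 1 ≤ B₁ by linarith) with hB1' | hB1'
        · rcases le_or_gt B₁ Bp with hp | hp
          · have := U3a B₁ (by linarith) hp hB1K; linarith
          · have := U4a B₁ (by linarith) (by linarith) hB1K
            have : (0 : ℝ) ≤ ρ * B₁ := mul_nonneg hρ (by linarith)
            linarith
        · subst hB1'
          have := P2 (by linarith)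
          rwa [show B₀ + 2 = B₀ + 1 + 1 by ring] at this
      -- the bracket `G = m(B₁) − m(B₂)` contains `g(B₁)` and `g(B₂−1)`: `g(B₁) ≤ G`, `g(B₂−1) ≤ G`, `g(B₁) + g(B₂−1) ≤ 2G`... precisely `g(B₁) + g(B₂ − 1) ≤ G` unless `B₂ = B₁ + 1`
      have G1 : m B₁ - m (B₁ + 1) ≤ m B₁ - m B₂ := by linarith [mK (B₁ + 1) B₂ (by linarith) (by linarith) h2]
      have G2 : m (B₂ - 1) - m B₂ ≤ m B₁ - m B₂ := by linarith [mK B₁ (B₂ - 1) h1 (by linarith) (by linarith)]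
      have G12 : (m B₁ - m (B₁ + 1)) + (m (B₂ - 1) - m B₂) ≤ 2 * (m B₁ - m B₂) := by
        rcases lt_or_eq_of_le (show B₁ + 1 ≤ B₂ by linarith) with h' | h'
        · have := mK (B₁ + 1) (B₂ - 1) (by linarith) (by linarith) (by linarith)
          linarith
        · rw [← h', show B₁ + 1 - 1 = B₁ by ring]; linarith
      have s2 := gsum B₁ B₂ h1 h12 h2
      have gpos : 0 ≤ m (B₂ - 1) - m B₂ := by have := hg0 (B₂ - 1) (by linarith) (by linarith); rw [sub_add_cancel] at this; linarith
      have Gpos : 0 ≤ m B₁ - m B₂ := by have := mul_nonneg (by linarith : (0 : ℝ) ≤ (B₂ : ℝ) - B₁) gpos; linarith [s2]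
      have βG : β * (2 * (m B₁ - m B₂)) ≤ 1 / 6 * (2 * (m B₁ - m B₂)) := mul_le_mul_of_nonneg_right hβ1 (by linarith)
      have βG12 := mul_le_mul_of_nonneg_left G12 hβ0.le
      rcases le_or_gt B₂ Bp with hp | hp
      · -- pool: `G ≥ (B₂ − B₁)·8ρ`
        have gl := Q2a (B₂ - 1) (by linarith) (by linarith) (by linarith)
        rw [sub_add_cancel] at gl
        have up2 := U3 B₂ (by linarith) hp h2
        have key : 8 * ρ * ((B₂ : ℝ) - B₁) ≤ m B₁ - m B₂ := by
          have := mul_le_mul_of_nonneg_left gl (by linarith : (0 : ℝ) ≤ (B₂ : ℝ) - B₁); linarith [s2]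
        have p := mul_le_mul_of_nonneg_left h12r hρ
        linarith [low1, up2, βG, βG12, key, ρβ, p]
      · -- far: the surplus `ρB₂` pays
        have up2 := U4 B₂ (by linarith) (by linarith) h2
        have p := mul_le_mul_of_nonneg_left (show β ≤ (B₁ : ℝ) by linarith) hρ
        linarith [low1, up2, βG, βG12, Gpos, p]

end Summit.Ventures.LatticeQCDFlow.Scaling

end
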